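import Summits.NavierStokesRegularity.NavierStokesRegularity.Theses.VortexLineClock

/-!
# Birth skeleton (BC3) for crux `VortexLineClock.EmptyEulerWindow` (stmt-NavierStokesRegularity-11273)

planner-skel-stmt-NavierStokesRegularity-11273-0 · skeleton-register (BC3, one-shot) · 2026-08-17.
Route `route-NavierStokesRegularity-VortexLineClock` (rev 0, open), crux #3 (rank 3, OPEN,
difficulty open-problem; shared as a support with route `AffineBernoulli`):

**THE EULER WINDOW IS EMPTY** — there is no triple `(γ, U, Ω)` with `2/5 ≤ γ < 1/2`, `U ∈ C²`,
`Ω ∈ C¹`, `div U = 0`, `m Ω = curl U` (`m > 0`), `U, Ω` globally Lipschitz, solving the stationary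
self-similar Euler system in velocity AND vorticity form about some centre `c`
(`(1−γ)U + DU·(γ(y−c)+U) + ∇P = 0`, `DΩ·(γ(y−c)+U) − DU·Ω = −Ω`), with CIV matched decay
`|Ω(y)| ≤ C⟨y⟩^{−1/γ}`, `|U(y)| ≤ C⟨y⟩^{1−1/γ}` and the normalisation `‖Ω 0‖ = 1`
(Constantin–Ignatova–Vicol, arXiv:2602.17570, §3: known empty under the OUTGOING property,
Thms 3.8/3.10, and in the axisymmetric classes, Thms 4.4/4.6; open for non-outgoing profiles).

## The line — FLUX CAPACITY · SEIFERT RESIDUAL · PROFILE CLOCK (the route's own `WindowGlue`)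

The route files the intended proof of this crux as three support items and the pure-logic glue
`WindowGlue : FluxCapacityRecurrence → SeifertResidual → ProfileClockNoCycle → EmptyEulerWindow`
(route header: "Intended proof = WindowGlue"; TWO-LAYER PLAN: "file `--split EmptyEulerWindow` once
one of them closes"). This skeleton types exactly that plan: the three stubs ARE the three support
items, BY NAME (fully-qualified route decls as signatures), so that landing a stub
(`propose --supports stmt-NavierStokesRegularity-11273`) closes the corresponding item as well
(stmt-11276 / stmt-11275 / stmt-11277), and the composition `EmptyEulerWindow_of` is the glue,
kernel-checked here (sorry-free; it is also the content of support item stmt-11280 `WindowGlue`).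

* S1 `stub_fluxCapacityRecurrence` = `VortexLineClock.FluxCapacityRecurrence` (stmt-11276;
  size L in Lean, TRUE — grounded provable-now): for a window profile, a.e. point `y` with
  `Ω y ≠ 0` is positively recurrent along its (unique) vortex line `x' = Ω(x)`, `x 0 = y`.
* S2 `stub_seifertResidual` = `VortexLineClock.SeifertResidual` (stmt-11275; OPEN — the HARDEST
  stub, the bet of the crux): a window profile whose vortex-line flow is a.e. recurrent on
  `{Ω ≠ 0}` carries a CLOSED vortex line (`τ`-periodic solution of `x' = Ω(x)`, `τ > 0`, through a
  point with `Ω ≠ 0`).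
* S3 `stub_profileClockNoCycle` = `VortexLineClock.ProfileClockNoCycle` (stmt-11277; size L in
  Lean, TRUE — grounded provable-now, stated for the bare affine structure, no window hypothesis):
  if `U, Ω ∈ C¹` are globally Lipschitz, `γ ≠ −1` and `DΩ·(γ(y−c)+U) − DU·Ω = −Ω`, then `x' = Ω(x)`
  has no non-stationary periodic orbit.

Composition `EmptyEulerWindow_of : S1 → S2 → S3 → EmptyEulerWindow` (proved below, pure logic,
standard axioms): given a window profile `(γ, U, Ω)`, S1 gives a.e. recurrence, S2 a closed vortex
line through a point with `Ω ≠ 0`; the window clauses supply `γ ≠ −1` (from `2/5 ≤ γ`), `U ∈ C¹`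
(from `C²`), `Ω ∈ C¹`, the common Lipschitz constant and — choosing the centre `c` from the
profile-equation clause — the vorticity equation, so S3 forbids that closed line: contradiction.

## Why each stub is plausible, and what it leans on

* S1 (TRUE; refuters g43-30/g43-37/g43-34 and grounders g20-41/g20-42/g20-49 on stmt-11276, with
  the in-tree engine map). `Ω = m⁻¹ curl U` is divergence-free (`U ∈ C²`), `C¹` and globally
  Lipschitz, so its flow is complete (`Literature.Analysis.ODE.lipschitzFlow`,
  `hasDerivAt_lipschitzFlow`, `eq_lipschitzFlow_of_hasDerivAt`, `lipschitzFlow_add`,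
  `contDiff_lipschitzFlow`) and Lebesgue-preserving (Liouville: `det DΦ_s = exp ∫ div Ω = 1`,
  `Literature.Analysis.ODE.det_eq_exp_mul_of_trace_eq` + the area formula
  `MeasureTheory.lintegral_abs_det_fderiv_eq_addHaar_image`, as in
  `Literature.Analysis.FluidPDE.Torus.volume_image_eq_of_det_one`). SLOW ESCAPE: the decay clause
  gives `|Ω(y)| ≤ C(1+|y|)^{−α}`, `α = 1/γ > 2`, so a trajectory issued from `B_R` stays in
  `B_{R(s)}`, `R(s) = ((1+R)^{1+α} + (1+α)Cs)^{1/(1+α)} ~ s^{1/(1+α)}`; hence `n` disjoint iterates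
  `Φ_1^k(W)`, `k < n`, of a wandering set `W ⊆ B_R` of the time-one map fit in a ball of volume
  `O(n^{3/(1+α)}) = o(n)` (because `α > 2`), forcing `λ(W) = 0`: the time-one map is CONSERVATIVE
  (Mathlib `MeasureTheory.Conservative`), and `Conservative.ae_frequently_mem_of_mem_nhds` /
  `Conservative.ae_mem_imp_frequently_image_mem` give a.e. recurrence at integer times, which is
  the stub's conclusion by uniqueness of vortex lines. The decay clause is essential here and only
  here: the refuters' non-decaying linear witnesses on this crux (`U = Ay`, `Ω ≡ e₃`, evidence
  DecayDrop.lean / Mutation.lean / NonDecayWitness.lean / Witness.lean) have straight, wandering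
  vortex lines. [ConstantinIgnatovaVicol2026Putative §3.1; MajdaBertozzi2002; Hartman Ch. V]
* S2 (OPEN). As a bare dynamical statement ("an a.e.-recurrent volume-preserving Lipschitz flow on
  `ℝ³` has a closed orbit") it is FALSE (G. Kuperberg 1996: `C¹`/real-analytic volume-preserving
  aperiodic flows; refuters g41-13, g43-34), and refuter g43-9's mutation witness shows that the two
  self-similar profile equations carry all the content (drop them, keep decay/div-free/recurrence:
  false). What the line bets on is the extra structure of a window profile: the affine pair
  `[V, Ω] = −(1+γ)Ω`, `V = γ(y−c)+U` (in tree: `Literature.Analysis.FluidPDE.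
  IsSelfSimilarEulerVorticityProfile.fderiv_curl_transport_sub_fderiv_transport_curl`, reached from
  the inlined clauses by `isSelfSimilarEulerVorticityProfile_of_smul_eq_curl`), which transports
  recurrence to infinity and rescales return times; contact/Reeb structure where `U·Ω ≠ 0`
  (Etnyre–Ghrist 2000); twist ⇒ Poincaré–Birkhoff on invariant tori; analyticity at Lagrangian
  stagnation points (CIV Prop. 3.9); the outgoing/nodal-set analysis of CIV §3.5 (in tree:
  `Literature.Analysis.FluidPDE.half_le_of_isLocallyOutgoing`, `selfSimilarNodalSet_subset_ball`).
  Logically S2 is the crux in RESIDUAL form: modulo S1 and S3 it is equivalent to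
  `EmptyEulerWindow` (contradiction architecture, refuter g43-37) — weaker than the crux exactly by
  the recurrence hypothesis it is handed. No cheap counterexample exists inside the class (it would
  be a self-similar Euler blow-up profile, refuter g43-28). [Kuperberg1996, EtnyreGhrist2000,
  ConstantinIgnatovaVicol2026Putative, arXiv:2511.16254]
* S3 (TRUE; refuters g41-13/g43-28/g43-37/g43-34, grounder g20-41 on stmt-11277). `V := γ(y−c)+U`
  is `C¹` and globally Lipschitz (constant `|γ| + L`), so `Ψ_τ := lipschitzFlow` of `V` is complete
  and `C¹` in the point (`contDiff_lipschitzFlow`); `DV = γ·id + DU` turns the typed clause into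
  `[V, Ω] = DΩ·V − DV·Ω = −(1+γ)Ω`. Both `a(τ) = DΨ_τ(y)Ω(y)` and `b(τ) = e^{(1+γ)τ} Ω(Ψ_τ y)` solve
  the linear ODE `w' = DV(Ψ_τ y) w`, `w(0) = Ω(y)`, hence coincide (Grönwall /
  `ODE_solution_unique_of_mem_Icc_right`; pattern `Literature.Analysis.ODE.fderiv_localFlow_apply_field`).
  Consequently `s ↦ Ψ_τ(x(s))` is an `Ω`-orbit run at speed `e^{(1+γ)τ}`: a closed vortex line of
  period `p` through `x 0` with `Ω(x 0) ≠ 0` yields closed vortex lines of every period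
  `p e^{−(1+γ)τ}`, `τ ∈ ℝ`, through points where `Ω ≠ 0` (`DΨ_τ` is invertible), and `1+γ ≠ 0` makes
  these arbitrarily short — contradicting Yorke's bound `p ≥ 2π/L`, PROVED in the tree
  (`Literature.Analysis.ODE.Yorke1969_periodBound_holds`, specialised to `ℝ³` as
  `yorke1969_periodBound_fin3` = the route's support item `YorkePeriodBound` verbatim). `γ = −1` is a
  genuine exception (`U = 0`, `Ω` a rotation field: all orbits closed), excluded by the hypothesis.
  [Yorke1969; Lee 2012 Prop. 9.41; ConstantinIgnatovaVicol2026Putative §3.4.1]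

## Disproof used / negatives / dead lines

No `Disproof.lean`, no `Negative/` lemma, no idea card and no earlier line exist for this crux
(`ledger crux ls stmt-NavierStokesRegularity-11273`: no workfiles, 2026-08-17) — there is no
`_false_without_<H>` obligation to honour. The refuters' crux attacks (12 evidence files on the item,
2026-08-15: DecayDrop.lean, Mutation.lean, NonDecayWitness.lean, Witness.lean,
CruxAttackEmptyEulerWindow.lean, W.lean, …) establish: the statement SURVIVES; the DECAY clause is
load-bearing (four Lean witnesses) — honoured: S1 consumes it; the normalisation `‖Ω 0‖ = 1` is the
junk guard (zero profile) — honoured: it travels inside the window clause to S1/S2 and the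
composition never needs `Ω ≢ 0` separately (S2 outputs a point with `Ω ≠ 0`); the two PDE clauses
are mutually consistent (vorticity clause = curl of the velocity clause). Negatives index
(`ledger negatives --problem NavierStokesRegularity`, 4 items: 4055 FiniteTangentModuli,
1832 PerpetualPump.Thesis, 1429 CorrectorSolvable, 0154 BlowupClayNonuniqueness): none concerns
self-similar Euler profiles, recurrence or closed vortex lines; no stub restates one.

## BC3 audit (registrar, 2026-08-17; raw outputs in the registrar's NOTES.md / bc/ folder)

`lean check --json`: rc 0, sorries = 3 = the three `stub_*` (zero elsewhere; `EmptyEulerWindow_of`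
standard axioms). Probes importing ONLY this route file (hence the Statement), one tactic per
`example`, `maxHeartbeats 400000` each — `exact?` · `simpa` · `simpa [defs]` · `unfold; simpa` ·
`aesop` · `unfold; aesop` · `intro; exact?`: `S → EmptyEulerWindow` FAILS 7/7 and
`S → NavierStokesRegularity` FAILS 7/7 for each of S1, S2, S3 (42/42; the `unfold; aesop` runs on
S1/S2 end by heartbeat exhaustion, all others by honest failure). Recorded converse: the crux
implies S1 and S2 VACUOUSLY (`fun h γ U Ω hW => (h γ U Ω hW).elim`) — both are consequences used
TOWARD the crux here, as BC2 allows; the crux does not cheaply imply S3 (probe fails). Dedup: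
`example : S := by exact?` FAILS for S1, S2, S3 and for the crux (nothing landed proves them yet;
candidate proofs are attached as evidence on stmt-11276/11277 but not in the tree).
-/

noncomputable section

set_option linter.dupNamespace false

namespace Summit.NavierStokesRegularity.NavierStokesRegularity.Cruxes.EmptyEulerWindow.Birth

open Summit.NavierStokesRegularity.NavierStokesRegularity.Theses.VortexLineClock

/-! ## The stubs S1–S3 (the only `sorry`s of the file; signatures = the route's support decls) -/

/-- **S1 `stub_fluxCapacityRecurrence` — FLUX CAPACITY / SLOW-ESCAPE RECURRENCE** (= support item
stmt-NavierStokesRegularity-11276 `FluxCapacityRecurrence`, verbatim by name). For a window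
profile `(γ, U, Ω)` (clauses as in the crux), for a.e. `y : ℝ³` with `Ω y ≠ 0`, every solution
`x` of `x' = Ω(x)` with `x 0 = y` returns `ε`-close to `y` at arbitrarily late times. Size L.
WHY TRUE: complete volume-preserving flow of the `C¹`, globally Lipschitz, divergence-free field
`Ω = m⁻¹ curl U`; slow escape `|Φ_s y| ≲ s^{1/(1+α)}`, `α = 1/γ > 2`, makes every wandering set of
the time-one map Lebesgue-null (`n` disjoint iterates inside a ball of volume `o(n)`), so the
time-one map is `MeasureTheory.Conservative` and Poincaré recurrence
(`Conservative.ae_frequently_mem_of_mem_nhds`) applies; uniqueness of vortex lines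
(`Literature.Analysis.ODE.eq_lipschitzFlow_of_hasDerivAt`) identifies `x s` with `Φ_s y`.
Leans on: `Literature.Analysis.ODE.lipschitzFlow` API (LipschitzFlow.lean), Liouville
`Literature.Analysis.ODE.det_eq_exp_mul_of_trace_eq` + Mathlib
`lintegral_abs_det_fderiv_eq_addHaar_image`, `Literature.Analysis.FluidPDE.VectorCalculus`
(`IsDivFree`, `curl`, div curl = 0), Mathlib `MeasureTheory.Conservative`.
[ConstantinIgnatovaVicol2026Putative §3.1 (3.7); MajdaBertozzi2002 §1; Kuperberg1996 (contrast)] -/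
theorem stub_fluxCapacityRecurrence :
    Summit.NavierStokesRegularity.NavierStokesRegularity.Theses.VortexLineClock.FluxCapacityRecurrence := by
  sorry

/-- **S2 `stub_seifertResidual` — THE SEIFERT RESIDUAL** (= support item
stmt-NavierStokesRegularity-11275 `SeifertResidual`, verbatim by name; OPEN — the hardest stub).
A window profile `(γ, U, Ω)` whose vortex-line flow is a.e. recurrent on `{Ω ≠ 0}` (the
conclusion of S1) has a closed vortex line: `x : ℝ → ℝ³`, `τ > 0`, `x' = Ω(x)`,
`x (s + τ) = x s`, `Ω (x 0) ≠ 0`. Size: open problem (the crux's difficulty lives here, by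
design of the route: "the open residual"). WHY PLAUSIBLE: false for general volume-preserving
`C¹` flows (Kuperberg 1996), but a window profile carries the affine symmetry
`[V, Ω] = −(1+γ)Ω`, `V = γ(y−c)+U` (`Ψ_τ` conjugates the vortex-line flow to itself sped up by
`e^{(1+γ)τ}` and maps the recurrent set to itself), contact/Reeb structure where `U·Ω ≠ 0`
(Etnyre–Ghrist), analyticity at Lagrangian stagnation points (CIV Prop. 3.9) and the CIV far-field
structure (large labels outgoing, bounded nodal set); engines foreseen by the route: contact branch
(Reeb-type closed orbit) / integrable branch (first integral, invariant tori, twist ⇒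
Poincaré–Birkhoff, or isochronous ⇒ linear conjugacy contradicting the affine pair). WHY IT MIGHT
FAIL: a Lipschitz window profile with saddle-type (non-outgoing) stagnation points and an aperiodic
recurrent vortex-line flow — nothing in print forbids it (constructions need the outgoing property,
arXiv:2511.16254 Hyp. 6.7). Leans on: `Literature.Analysis.FluidPDE.
isSelfSimilarEulerVorticityProfile_of_smul_eq_curl`, `IsSelfSimilarEulerVorticityProfile.
fderiv_curl_transport_sub_fderiv_transport_curl`, `selfSimilarNodalSet_subset_ball`,
`half_mul_sq_le_inner_transport` (SelfSimilarEulerProfile(Vorticity).lean), S1's flow toolkit.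
[Kuperberg1996, EtnyreGhrist2000, ConstantinIgnatovaVicol2026Putative §3.5 Prop. 3.9, arXiv:2511.16254] -/
theorem stub_seifertResidual :
    Summit.NavierStokesRegularity.NavierStokesRegularity.Theses.VortexLineClock.SeifertResidual := by
  sorry

/-- **S3 `stub_profileClockNoCycle` — THE SELF-SIMILAR VORTEX-LINE CLOCK** (= support item
stmt-NavierStokesRegularity-11277 `ProfileClockNoCycle`, verbatim by name). If `U, Ω ∈ C¹(ℝ³; ℝ³)`
are globally Lipschitz (common constant `L`), `γ ≠ −1`, and
`DΩ(y)(γ(y−c)+U y) − DU(y)(Ω y) = −Ω y` for all `y`, then `x' = Ω(x)` has no `τ`-periodic solution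
(`τ > 0`) through a point where `Ω ≠ 0`. Size L (Lean-heavy, mathematically routine). WHY TRUE:
with `V = γ(y−c)+U`, `DV = γ·id + DU`, the hypothesis is `[V, Ω] = −(1+γ)Ω`; the complete `C¹`
flow `Ψ_τ` of `V` satisfies `DΨ_τ(y) Ω(y) = e^{(1+γ)τ} Ω(Ψ_τ y)` (both sides solve
`w' = DV(Ψ_τ y) w`, `w(0) = Ω(y)`), so `Ψ_τ` maps a closed vortex line of period `p` to closed
vortex lines of period `p e^{−(1+γ)τ}` through points with `Ω ≠ 0`; `τ → ±∞` contradicts Yorke's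
bound `p ≥ 2π/L` (PROVED in tree). Leans on: `Literature.Analysis.ODE.lipschitzFlow`,
`contDiff_lipschitzFlow`, `lipschitzFlow_add`, `Literature.Analysis.ODE.fderiv_localFlow_apply_field`
(pattern), Mathlib `ODE_solution_unique_of_mem_Icc_right` / `gronwall`,
`Literature.Analysis.ODE.Yorke1969_periodBound_holds`, `yorke1969_periodBound_fin3`.
[Yorke1969 Thm. p. 509; ConstantinIgnatovaVicol2026Putative §3.4.1; arXiv:2602.17570] -/
theorem stub_profileClockNoCycle :
    Summit.NavierStokesRegularity.NavierStokesRegularity.Theses.VortexLineClock.ProfileClockNoCycle := by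
  sorry

/-! ## The composition (kernel-checked, sorry-free): S1 → S2 → S3 → the crux, BY NAME -/

/-- **`EmptyEulerWindow` from the three stub statements** — the route's `WindowGlue`, proved:
a window profile would have an a.e.-recurrent vortex-line flow (S1), hence a closed vortex line
through a point with `Ω ≠ 0` (S2), which the self-similar clock forbids (S3; the window clauses give
`γ ≠ −1` from `2/5 ≤ γ`, `U ∈ C¹` from `U ∈ C²`, the Lipschitz pair, and the vorticity equation about
the centre `c` chosen from the profile-equation clause). The hypotheses are the registered stubs'
signatures verbatim (route items, admissible heads for `#h21_check_skeleton`); the conclusion is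
literally the route decl. -/
theorem EmptyEulerWindow_of :
    Summit.NavierStokesRegularity.NavierStokesRegularity.Theses.VortexLineClock.FluxCapacityRecurrence →
    Summit.NavierStokesRegularity.NavierStokesRegularity.Theses.VortexLineClock.SeifertResidual →
    Summit.NavierStokesRegularity.NavierStokesRegularity.Theses.VortexLineClock.ProfileClockNoCycle →
      Summit.NavierStokesRegularity.NavierStokesRegularity.Theses.VortexLineClock.EmptyEulerWindow := by
  intro hFlux hSeifert hClock γ U Ω hW
  -- S1 (flux capacity / slow escape): a.e. vortex line of the window profile is recurrent.
  have hrec := hFlux γ U Ω hW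
  -- S2 (Seifert residual): recurrence yields a closed vortex line through a point with `Ω ≠ 0`.
  obtain ⟨x, τ, hτ, hx, hper, hx0⟩ := hSeifert γ U Ω hW hrec
  -- Unpack the window clauses the clock needs: `2/5 ≤ γ`, `U ∈ C²`, `Ω ∈ C¹`, the Lipschitz pair,
  -- and the vorticity equation about the centre `c` of the profile-equation clause.
  obtain ⟨hγlo, -, hU2, hΩ1, -, -, hLip, ⟨c, P, -, -, hvort⟩, -, -⟩ := hW
  have hγ : γ ≠ -1 := by
    intro h
    linarith
  have hU1 : ContDiff ℝ 1 U := hU2.of_le (by norm_num)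
  -- S3 (the clock): no closed vortex line — contradiction.
  exact hClock γ c U Ω hγ hU1 hΩ1 hLip hvort ⟨x, τ, hτ, hx, hper, hx0⟩

/-- WIRING CHECK: the three sorried stubs compose to a closed term of the crux's type (modulo their
`sorry`s). Deliberately an `example` — no constant of type `EmptyEulerWindow` enters the
environment, so a probe importing this file cannot close `stub → EmptyEulerWindow` by `exact?`
through a pre-composed witness. -/
example : Summit.NavierStokesRegularity.NavierStokesRegularity.Theses.VortexLineClock.EmptyEulerWindow :=
  EmptyEulerWindow_of stub_fluxCapacityRecurrence stub_seifertResidual stub_profileClockNoCycle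

end Summit.NavierStokesRegularity.NavierStokesRegularity.Cruxes.EmptyEulerWindow.Birth

end
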